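import Summits.Ventures.YMGap.RobustBall.RowsSU3StarPV
import HarnessLib

/-!
# Venture YMGap, track ROBUST-BALL (Y2) — W17: TIER-2 (weighted ball) star rows in the PV-VARIANCE form — schemas for every `N ≥ 2` and the
# HYPOTHESIS-FREE `SU(3)` cells (`d = 4` torus clustering, `d = 3` Y4 weighted currency)

HONEST FRAMING. WHAT THIS IS: a venture file (cell `pub-ymgap`, track Y2 ROBUST-BALL, seat ds-2): the weighted robust star door in variance form
(`clustersWith_of_robustStarW_variance`, `RobustStarDoorVariance`) fed with the hypothesis-free pair Bakry–Émery Poincaré × engine-2's Schwinger–Dyson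
variance (inputs `pvVariance_star_inputs` of `RobustStarDoorPV`): schemas `suN_torusClusteringOnBallW_star_pv` (`d = 4`) and
`suN_clusterDomainClusteringW_dim3_star_pv` (`d = 3`), and `SU(3)` cells on the one-parameter weighted ball `ClusterDomain κ (2ε) ε`.
`SU(3)` CELLS (β_W, ε), HYPOTHESIS-FREE, class K — `d = 4` (`TorusClusteringOnBallW 3 4 β κ (2ε) ε (24e^{2t}) t`, `0 ≤ β ≤ β_W/3`): rate `t = 1/100` for
every `κ ≥ 1/100`: (1/8, .259) (1/5, .167) (1/4, .100); `κ = t = log 6/5`: (1/4, .062) (screened, not typed: (1/8, .201) (1/5, .120)); `d = 3` (Y4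
`ClusterDomainClustering ⟨ρ₃, β_W/3, ClusterDomain κ (2ε) ε⟩ suFrobDist t` + torus form): `t = 1/100`: (1/3, .142); `log 6/5`: (1/3, .098) (screened, not
typed: t = 1/100 (1/4, .211) (2/5, .083); log 6/5 (1/4, .159) (2/5, .047)). BEFORE (hypothesis-free tier 2): eigen `TorusRowsSU3StarW` (1/8, .146) … (1/4, .018); engine-2's KR-form PV
`StarRowsSU3PVW` (3272b523bfac). WHAT THIS IS NOT: torus currency; radii/rates are door artefacts; nothing about the continuum or the Millennium problem.
-/

noncomputable section

open Finset
open Literature.MathematicalPhysics.QuantumLattice (fundamentalRep)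
open Literature.MathematicalPhysics.QuantumFieldTheory hiding ZdEdge
open Literature.MathematicalPhysics.QuantumFieldTheory.Balaban1983to89.StrongCouplingTorusWindow
open Summit.QuantumFields.BalabanUV.InfraRed.StrongCouplingPoincareDoorSUN (OneLinkPoincareSUN oneLinkPoincareSUN_bakryEmery)
open Summit.QuantumFields.BalabanUV.InfraRed.StrongCouplingVarianceDoorSUN (OneLinkVarianceBound)
open Summit.Ventures.YMGap.OneLinkVarianceSD (oneLinkVarianceBound_sd)
open Summit.Ventures.YMGap.StarResolventDim (Delta gaugeR doorPoly Delta_pos_of_door gaugeR_lt_one_of_door)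

namespace Summit.Ventures.YMGap.RobustBall

variable {N : ℕ}

/-! ### Schemas, every `N ≥ 2`, tier 2 (weighted ball), PV-variance form -/

/-- **SCHEMA, `d = 4`, TIER 2, every `N ≥ 2`, PV-variance form**: `TorusClusteringOnBallW N 4 β κ ε₀ ε₁ (8N e^{2t}) t` for every `0 ≤ β ≤ β_W/N`
(`0 ≤ t ≤ κ`, `T₁ ≥ e^{t}`, `T₂ ≥ e^{2t}`, radius `R = 6β_W/N² < 1/2`). [folklore] -/
theorem suN_torusClusteringOnBallW_star_pv (Kn : ℕ) (hN : 2 ≤ N) {βW κ ε₀ ε₁ c lam E E₂ q₁ Ks Sq t T₁ T₂ : ℝ} (hβ0 : 0 < βW)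
    (hR : βW / (N : ℝ) ^ 2 * 6 < 1 / 2) (hε₁ : 0 ≤ ε₁) (ht : 0 ≤ t) (htκ : t ≤ κ) (hE : Real.exp ε₀ ≤ E) (hE₂ : Real.exp (ε₀ / 2) ≤ E₂)
    (hq₁0 : 0 ≤ q₁) (hq₁ : 1 + (N : ℝ) ^ 2 * (βW / (N : ℝ) ^ 2 * 6) ^ 2 / 4 ≤ q₁ ^ 2) (hKs0 : 0 ≤ Ks)
    (hKs : ((N : ℝ) * (βW / (N : ℝ) ^ 2 * 6) / 2 + q₁) ^ 2 / (1 / 2 - βW / (N : ℝ) ^ 2 * 6) ≤ Ks ^ 2) (hSq0 : 0 ≤ Sq)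
    (hSq : 1 / ((N : ℝ) * (1 / 2 - βW / (N : ℝ) ^ 2 * 6)) ≤ Sq ^ 2) (hT₁ : Real.exp t ≤ T₁) (hT₂ : Real.exp (2 * t) ≤ T₂)
    (hc : E * Ks * (βW / (N : ℝ) ^ 2) ≤ c) (hlam : E₂ * Sq * ε₁ ≤ lam) (hθ1 : 6 * c + lam < 1) (hcd : doorPoly 4 c < 1)
    (hρ1 : T₁ * (gaugeR 4 c + (T₂ * lam + (6 * c + lam) ^ Kn * (16 * (T₂ * lam))) / (1 - (6 * c + lam))) < 1) :
    ∀ β : ℝ, 0 ≤ β → β ≤ βW / N → TorusClusteringOnBallW N 4 β κ ε₀ ε₁ (8 * N * Real.exp (2 * t)) t := by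
  have hN1 : 1 ≤ N := by omega
  have hN0 : (0 : ℝ) < N := by exact_mod_cast (show 0 < N by omega)
  set R : ℝ := βW / (N : ℝ) ^ 2 * 6 with hRdef
  have hR0 : 0 ≤ R := by positivity
  have hP := oneLinkPoincareSUN_bakryEmery hN hR
  have hV := oneLinkVarianceBound_sd hN1 R
  obtain ⟨h1, h2⟩ := pvVariance_star_inputs hN (x := βW / (N : ℝ) ^ 2) hR0 hR hε₁ (by positivity) hE hE₂ hq₁0 hq₁ hKs0 hKs hSq0 hSq
  have hc0 : 0 ≤ c := le_trans (le_trans (by positivity) h1) hc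
  have hE20 : 0 ≤ E₂ := (Real.exp_pos _).le.trans hE₂
  have hlam0 : 0 ≤ lam := le_trans (by positivity) hlam
  set θ : ℝ := 6 * c + lam with hθ
  set ρ : ℝ := Real.exp t * (gaugeR 4 c +
    (Real.exp (2 * t) * lam + θ ^ Kn * (16 * (Real.exp (2 * t) * lam))) / (1 - θ)) with hρ
  have hθ0 : 0 ≤ θ := by positivity
  have h1θ : 0 < 1 - θ := by linarith
  have hgR := gaugeR_lt_one_of_door (d := 4) (by norm_num) hc0 hcd
  have hθK : 0 ≤ θ ^ Kn := pow_nonneg hθ0 Kn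
  have hin0 : 0 ≤ gaugeR 4 c + (Real.exp (2 * t) * lam + θ ^ Kn * (16 * (Real.exp (2 * t) * lam))) / (1 - θ) :=
    add_nonneg hgR.1 (div_nonneg (by positivity) h1θ.le)
  have hin : gaugeR 4 c + (Real.exp (2 * t) * lam + θ ^ Kn * (16 * (Real.exp (2 * t) * lam))) / (1 - θ) ≤
      gaugeR 4 c + (T₂ * lam + θ ^ Kn * (16 * (T₂ * lam))) / (1 - θ) := by
    have h1' : Real.exp (2 * t) * lam ≤ T₂ * lam := mul_le_mul_of_nonneg_right hT₂ hlam0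
    have h2' : θ ^ Kn * (16 * (Real.exp (2 * t) * lam)) ≤ θ ^ Kn * (16 * (T₂ * lam)) :=
      mul_le_mul_of_nonneg_left (by linarith) hθK
    exact add_le_add le_rfl (div_le_div_of_nonneg_right (add_le_add h1' h2') h1θ.le)
  have hρ1' : ρ < 1 :=
    calc ρ ≤ T₁ * (gaugeR 4 c + (T₂ * lam + θ ^ Kn * (16 * (T₂ * lam))) / (1 - θ)) :=
          mul_le_mul hT₁ hin hin0 ((Real.exp_pos _).le.trans hT₁)
      _ < 1 := hρ1
  have hβN : βW / (N : ℝ) / (N : ℝ) = βW / (N : ℝ) ^ 2 := by rw [div_div, sq]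
  have hb' : βW / (N : ℝ) / (N : ℝ) * (2 * (((4 : ℕ) : ℝ) - 1)) ≤ R := by rw [hβN, hRdef]; norm_num
  have hc' : Real.exp ε₀ * Real.sqrt (1 / ((N : ℝ) * (1 / 2 - R)) *
      ((N : ℝ) * ((N : ℝ) * R / 2 + Real.sqrt (1 + (N : ℝ) ^ 2 * R ^ 2 / 4)) ^ 2)) * (βW / (N : ℝ) / (N : ℝ)) ≤ c := by
    rw [hβN]; exact h1.trans hc
  have hθ' : θ = (2 * ((4 : ℕ) : ℝ) - 2) * c + lam := by rw [hθ]; push_cast; ring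
  have hρ' : ρ = Real.exp t * (gaugeR 4 c +
      (Real.exp (2 * t) * lam + θ ^ Kn * (4 * ((4 : ℕ) : ℝ) * (Real.exp (2 * t) * lam))) / (1 - θ)) := by
    rw [hρ]; push_cast; ring
  have h := torusClusteringOnBallW_upTo_of_robustStar_variance (d := 4) (N := N) (by norm_num) hN1 Kn (by positivity) (by positivity)
    hb' hP hV hε₁ ht htκ hc' (h2.trans hlam) hθ' hθ1 hcd hρ' hρ1'
  rw [two_mul_sq_two_sqrt_nat] at h
  exact h

/-- **SCHEMA, `d = 3`, TIER 2, every `N ≥ 2`, PV-variance form**: Y4's `ClusterDomainClustering` on `ClusterDomain κ ε₀ ε₁` up to `β_W/N` at rate `t`,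
plus the torus form (radius `R = 4β_W/N²`; door `8c² + 6c < 1`, `θ = 4c + λ`). [folklore] -/
theorem suN_clusterDomainClusteringW_dim3_star_pv (Kn : ℕ) (hN : 2 ≤ N) {βW κ ε₀ ε₁ c lam E E₂ q₁ Ks Sq t T₁ T₂ : ℝ} (hβ0 : 0 < βW)
    (hR : βW / (N : ℝ) ^ 2 * 4 < 1 / 2) (hε₁ : 0 ≤ ε₁) (ht : 0 ≤ t) (htκ : t ≤ κ) (hE : Real.exp ε₀ ≤ E) (hE₂ : Real.exp (ε₀ / 2) ≤ E₂)
    (hq₁0 : 0 ≤ q₁) (hq₁ : 1 + (N : ℝ) ^ 2 * (βW / (N : ℝ) ^ 2 * 4) ^ 2 / 4 ≤ q₁ ^ 2) (hKs0 : 0 ≤ Ks)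
    (hKs : ((N : ℝ) * (βW / (N : ℝ) ^ 2 * 4) / 2 + q₁) ^ 2 / (1 / 2 - βW / (N : ℝ) ^ 2 * 4) ≤ Ks ^ 2) (hSq0 : 0 ≤ Sq)
    (hSq : 1 / ((N : ℝ) * (1 / 2 - βW / (N : ℝ) ^ 2 * 4)) ≤ Sq ^ 2) (hT₁ : Real.exp t ≤ T₁) (hT₂ : Real.exp (2 * t) ≤ T₂)
    (hc : E * Ks * (βW / (N : ℝ) ^ 2) ≤ c) (hlam : E₂ * Sq * ε₁ ≤ lam) (hθ1 : 4 * c + lam < 1) (hcd : doorPoly 3 c < 1)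
    (hρ1 : T₁ * (gaugeR 3 c + (T₂ * lam + (4 * c + lam) ^ Kn * (12 * (T₂ * lam))) / (1 - (4 * c + lam))) < 1) :
    YM3IR.ClusterDomainClustering (G := SUN N)
        ⟨fundamentalRep (Fin N), βW / N, fun _ _ W => W ∈ ClusterDomain κ ε₀ ε₁⟩ suFrobDist t ∧
      ∀ β : ℝ, 0 ≤ β → β ≤ βW / N → TorusClusteringOnBallW N 3 β κ ε₀ ε₁ (8 * N * Real.exp (2 * t)) t := by
  have hN1 : 1 ≤ N := by omega
  have hN0 : (0 : ℝ) < N := by exact_mod_cast (show 0 < N by omega)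
  set R : ℝ := βW / (N : ℝ) ^ 2 * 4 with hRdef
  have hR0 : 0 ≤ R := by positivity
  have hP := oneLinkPoincareSUN_bakryEmery hN hR
  have hV := oneLinkVarianceBound_sd hN1 R
  obtain ⟨h1, h2⟩ := pvVariance_star_inputs hN (x := βW / (N : ℝ) ^ 2) hR0 hR hε₁ (by positivity) hE hE₂ hq₁0 hq₁ hKs0 hKs hSq0 hSq
  have hc0 : 0 ≤ c := le_trans (le_trans (by positivity) h1) hc
  have hE20 : 0 ≤ E₂ := (Real.exp_pos _).le.trans hE₂
  have hlam0 : 0 ≤ lam := le_trans (by positivity) hlam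
  set θ : ℝ := 4 * c + lam with hθ
  set ρ : ℝ := Real.exp t * (gaugeR 3 c +
    (Real.exp (2 * t) * lam + θ ^ Kn * (12 * (Real.exp (2 * t) * lam))) / (1 - θ)) with hρ
  have hθ0 : 0 ≤ θ := by positivity
  have h1θ : 0 < 1 - θ := by linarith
  have hgR := gaugeR_lt_one_of_door (d := 3) (by norm_num) hc0 hcd
  have hθK : 0 ≤ θ ^ Kn := pow_nonneg hθ0 Kn
  have hin0 : 0 ≤ gaugeR 3 c + (Real.exp (2 * t) * lam + θ ^ Kn * (12 * (Real.exp (2 * t) * lam))) / (1 - θ) :=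
    add_nonneg hgR.1 (div_nonneg (by positivity) h1θ.le)
  have hin : gaugeR 3 c + (Real.exp (2 * t) * lam + θ ^ Kn * (12 * (Real.exp (2 * t) * lam))) / (1 - θ) ≤
      gaugeR 3 c + (T₂ * lam + θ ^ Kn * (12 * (T₂ * lam))) / (1 - θ) := by
    have h1' : Real.exp (2 * t) * lam ≤ T₂ * lam := mul_le_mul_of_nonneg_right hT₂ hlam0
    have h2' : θ ^ Kn * (12 * (Real.exp (2 * t) * lam)) ≤ θ ^ Kn * (12 * (T₂ * lam)) :=
      mul_le_mul_of_nonneg_left (by linarith) hθK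
    exact add_le_add le_rfl (div_le_div_of_nonneg_right (add_le_add h1' h2') h1θ.le)
  have hρ1' : ρ < 1 :=
    calc ρ ≤ T₁ * (gaugeR 3 c + (T₂ * lam + θ ^ Kn * (12 * (T₂ * lam))) / (1 - θ)) :=
          mul_le_mul hT₁ hin hin0 ((Real.exp_pos _).le.trans hT₁)
      _ < 1 := hρ1
  have hβN : βW / (N : ℝ) / (N : ℝ) = βW / (N : ℝ) ^ 2 := by rw [div_div, sq]
  have hb4 : βW / (N : ℝ) / (N : ℝ) * 4 ≤ R := by rw [hβN, hRdef]
  have hb' : βW / (N : ℝ) / (N : ℝ) * (2 * (((3 : ℕ) : ℝ) - 1)) ≤ R := by rw [hβN, hRdef]; norm_num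
  have hc' : Real.exp ε₀ * Real.sqrt (1 / ((N : ℝ) * (1 / 2 - R)) *
      ((N : ℝ) * ((N : ℝ) * R / 2 + Real.sqrt (1 + (N : ℝ) ^ 2 * R ^ 2 / 4)) ^ 2)) * (βW / (N : ℝ) / (N : ℝ)) ≤ c := by
    rw [hβN]; exact h1.trans hc
  have hθ' : θ = (2 * ((3 : ℕ) : ℝ) - 2) * c + lam := by rw [hθ]; push_cast; ring
  have hρ' : ρ = Real.exp t * (gaugeR 3 c +
      (Real.exp (2 * t) * lam + θ ^ Kn * (4 * ((3 : ℕ) : ℝ) * (Real.exp (2 * t) * lam))) / (1 - θ)) := by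
    rw [hρ]; push_cast; ring
  refine ⟨clusterDomainClusteringW_dim3_of_robustStar_variance (N := N) hN1 Kn (by positivity) (by positivity) hb4 hP hV hε₁ ht htκ
    hc' (h2.trans hlam) hθ hθ1 hcd hρ hρ1', ?_⟩
  have h := torusClusteringOnBallW_upTo_of_robustStar_variance (d := 3) (N := N) (by norm_num) hN1 Kn (by positivity) (by positivity)
    hb' hP hV hε₁ ht htκ hc' (h2.trans hlam) hθ' hθ1 hcd hρ' hρ1'
  rw [two_mul_sq_two_sqrt_nat] at h
  exact h

/-! ### The `SU(3)` tier-2 cells -/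

/-! ### Certified decimal majorants -/

/-- `e^{259 / 500} ≤ 1678701 / 1000000` (Mathlib's `Real.exp_bound'`, five terms). [folklore] -/
theorem exp_le_259_500_pvw : Real.exp (259 / 500) ≤ 1678701 / 1000000 := by
  have h := Real.exp_bound' (x := 259 / 500) (by norm_num) (by norm_num) (n := 5) (by norm_num)
  refine h.trans ?_
  simp only [Finset.sum_range_succ, Finset.sum_range_zero, Nat.factorial]
  norm_num

/-- `e^{259 / 1000} ≤ 323909 / 250000` (Mathlib's `Real.exp_bound'`, five terms). [folklore] -/
theorem exp_le_259_1000_pvw : Real.exp (259 / 1000) ≤ 323909 / 250000 := by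
  have h := Real.exp_bound' (x := 259 / 1000) (by norm_num) (by norm_num) (n := 5) (by norm_num)
  refine h.trans ?_
  simp only [Finset.sum_range_succ, Finset.sum_range_zero, Nat.factorial]
  norm_num

/-- `e^{167 / 500} ≤ 1396549 / 1000000` (Mathlib's `Real.exp_bound'`, five terms). [folklore] -/
theorem exp_le_167_500_pvw : Real.exp (167 / 500) ≤ 1396549 / 1000000 := by
  have h := Real.exp_bound' (x := 167 / 500) (by norm_num) (by norm_num) (n := 5) (by norm_num)
  refine h.trans ?_
  simp only [Finset.sum_range_succ, Finset.sum_range_zero, Nat.factorial]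
  norm_num

/-- `e^{167 / 1000} ≤ 236351 / 200000` (Mathlib's `Real.exp_bound'`, five terms). [folklore] -/
theorem exp_le_167_1000_pvw : Real.exp (167 / 1000) ≤ 236351 / 200000 := by
  have h := Real.exp_bound' (x := 167 / 1000) (by norm_num) (by norm_num) (n := 5) (by norm_num)
  refine h.trans ?_
  simp only [Finset.sum_range_succ, Finset.sum_range_zero, Nat.factorial]
  norm_num

/-- `e^{1 / 5} ≤ 305351 / 250000` (Mathlib's `Real.exp_bound'`, five terms). [folklore] -/
theorem exp_le_1_5_pvw : Real.exp (1 / 5) ≤ 305351 / 250000 := by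
  have h := Real.exp_bound' (x := 1 / 5) (by norm_num) (by norm_num) (n := 5) (by norm_num)
  refine h.trans ?_
  simp only [Finset.sum_range_succ, Finset.sum_range_zero, Nat.factorial]
  norm_num

/-- `e^{31 / 250} ≤ 70751 / 62500` (Mathlib's `Real.exp_bound'`, five terms). [folklore] -/
theorem exp_le_31_250_pvw : Real.exp (31 / 250) ≤ 70751 / 62500 := by
  have h := Real.exp_bound' (x := 31 / 250) (by norm_num) (by norm_num) (n := 5) (by norm_num)
  refine h.trans ?_
  simp only [Finset.sum_range_succ, Finset.sum_range_zero, Nat.factorial]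
  norm_num

/-- `e^{31 / 500} ≤ 1063963 / 1000000` (Mathlib's `Real.exp_bound'`, five terms). [folklore] -/
theorem exp_le_31_500_pvw : Real.exp (31 / 500) ≤ 1063963 / 1000000 := by
  have h := Real.exp_bound' (x := 31 / 500) (by norm_num) (by norm_num) (n := 5) (by norm_num)
  refine h.trans ?_
  simp only [Finset.sum_range_succ, Finset.sum_range_zero, Nat.factorial]
  norm_num

/-- `e^{71 / 250} ≤ 332109 / 250000` (Mathlib's `Real.exp_bound'`, five terms). [folklore] -/
theorem exp_le_71_250_pvw : Real.exp (71 / 250) ≤ 332109 / 250000 := by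
  have h := Real.exp_bound' (x := 71 / 250) (by norm_num) (by norm_num) (n := 5) (by norm_num)
  refine h.trans ?_
  simp only [Finset.sum_range_succ, Finset.sum_range_zero, Nat.factorial]
  norm_num

/-- `e^{71 / 500} ≤ 1152577 / 1000000` (Mathlib's `Real.exp_bound'`, five terms). [folklore] -/
theorem exp_le_71_500_pvw : Real.exp (71 / 500) ≤ 1152577 / 1000000 := by
  have h := Real.exp_bound' (x := 71 / 500) (by norm_num) (by norm_num) (n := 5) (by norm_num)
  refine h.trans ?_
  simp only [Finset.sum_range_succ, Finset.sum_range_zero, Nat.factorial]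
  norm_num

/-- **TIER-2 ROW `(β_W, ε) = (1 / 8, 259 / 1000)`, `SU(3)`, `d = 4`, HYPOTHESIS-FREE, PV-variance star door**, rate `1/100` per lattice unit, EVERY weight `κ ≥ 1/100`
(certificate: `K_s = 1754903 / 1000000`, `S_q = 894429 / 1000000`, `c = 40917 / 1000000`, `λ = 18759 / 62500`, `ρ ≈ 0.9932`). [folklore] -/
theorem su3_torusClusteringOnBallW_starPV_oneEighth_t100 :
    ∀ κ : ℝ, 1 / 100 ≤ κ → ∀ β : ℝ, 0 ≤ β → β ≤ 1 / 24 →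
      TorusClusteringOnBallW 3 4 β κ (259 / 500) (259 / 1000) (24 * Real.exp (1 / 50)) (1 / 100) := by
  intro κ hκ
  have e1 : (1 / 8 : ℝ) / ((3 : ℕ) : ℝ) = 1 / 24 := by norm_num
  have e3 : (8 : ℝ) * ((3 : ℕ) : ℝ) = 24 := by norm_num
  have h := suN_torusClusteringOnBallW_star_pv 20 (N := 3) (by norm_num) (βW := 1 / 8) (κ := κ) (ε₀ := 259 / 500) (ε₁ := 259 / 1000) (c := 40917 / 1000000)
    (lam := 18759 / 62500) (E₂ := 323909 / 250000) (q₁ := 125973 / 125000) (Ks := 1754903 / 1000000) (Sq := 894429 / 1000000) (t := 1 / 100)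
    (T₁ := 1010051 / 1000000) (T₂ := 510101 / 500000) (by norm_num) (by norm_num) (by norm_num) (by norm_num) hκ
    exp_le_259_500_pvw (by rw [show (259 / 500 : ℝ) / 2 = 259 / 1000 by norm_num]; exact exp_le_259_1000_pvw) (by norm_num) (by norm_num) (by norm_num) (by norm_num)
    (by norm_num) (by norm_num) exp_le_1_100_w (by rw [show (2:ℝ) * (1 / 100) = 1 / 50 by norm_num]; exact exp_le_1_50_w)
    (by norm_num) (by norm_num) (by norm_num) (by unfold doorPoly; norm_num) (by unfold gaugeR Delta; norm_num)
  have e2 : (2 : ℝ) * (1 / 100) = 1 / 50 := by norm_num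
  rw [e1, e2, e3] at h
  exact h

/-- **TIER-2 ROW `(β_W, ε) = (1 / 5, 167 / 1000)`, `SU(3)`, `d = 4`, HYPOTHESIS-FREE, PV-variance star door**, rate `1/100` per lattice unit, EVERY weight `κ ≥ 1/100`
(certificate: `K_s = 2014443 / 1000000`, `S_q = 119183 / 125000`, `c = 31259 / 500000`, `λ = 18817 / 100000`, `ρ ≈ 0.9982`). [folklore] -/
theorem su3_torusClusteringOnBallW_starPV_oneFifth_t100 :
    ∀ κ : ℝ, 1 / 100 ≤ κ → ∀ β : ℝ, 0 ≤ β → β ≤ 1 / 15 →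
      TorusClusteringOnBallW 3 4 β κ (167 / 500) (167 / 1000) (24 * Real.exp (1 / 50)) (1 / 100) := by
  intro κ hκ
  have e1 : (1 / 5 : ℝ) / ((3 : ℕ) : ℝ) = 1 / 15 := by norm_num
  have e3 : (8 : ℝ) * ((3 : ℕ) : ℝ) = 24 := by norm_num
  have h := suN_torusClusteringOnBallW_star_pv 20 (N := 3) (by norm_num) (βW := 1 / 5) (κ := κ) (ε₀ := 167 / 500) (ε₁ := 167 / 1000) (c := 31259 / 500000)
    (lam := 18817 / 100000) (E₂ := 236351 / 200000) (q₁ := 203961 / 200000) (Ks := 2014443 / 1000000) (Sq := 119183 / 125000) (t := 1 / 100)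
    (T₁ := 1010051 / 1000000) (T₂ := 510101 / 500000) (by norm_num) (by norm_num) (by norm_num) (by norm_num) hκ
    exp_le_167_500_pvw (by rw [show (167 / 500 : ℝ) / 2 = 167 / 1000 by norm_num]; exact exp_le_167_1000_pvw) (by norm_num) (by norm_num) (by norm_num) (by norm_num)
    (by norm_num) (by norm_num) exp_le_1_100_w (by rw [show (2:ℝ) * (1 / 100) = 1 / 50 by norm_num]; exact exp_le_1_50_w)
    (by norm_num) (by norm_num) (by norm_num) (by unfold doorPoly; norm_num) (by unfold gaugeR Delta; norm_num)
  have e2 : (2 : ℝ) * (1 / 100) = 1 / 50 := by norm_num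
  rw [e1, e2, e3] at h
  exact h

/-- **TIER-2 ROW `(β_W, ε) = (1 / 4, 1 / 10)`, `SU(3)`, `d = 4`, HYPOTHESIS-FREE, PV-variance star door**, rate `1/100` per lattice unit, EVERY weight `κ ≥ 1/100`
(certificate: `K_s = 1109187 / 500000`, `S_q = 1000001 / 1000000`, `c = 15053 / 200000`, `λ = 55259 / 500000`, `ρ ≈ 0.9977`). [folklore] -/
theorem su3_torusClusteringOnBallW_starPV_oneQuarter_t100 :
    ∀ κ : ℝ, 1 / 100 ≤ κ → ∀ β : ℝ, 0 ≤ β → β ≤ 1 / 12 →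
      TorusClusteringOnBallW 3 4 β κ (1 / 5) (1 / 10) (24 * Real.exp (1 / 50)) (1 / 100) := by
  intro κ hκ
  have e1 : (1 / 4 : ℝ) / ((3 : ℕ) : ℝ) = 1 / 12 := by norm_num
  have e3 : (8 : ℝ) * ((3 : ℕ) : ℝ) = 24 := by norm_num
  have h := suN_torusClusteringOnBallW_star_pv 20 (N := 3) (by norm_num) (βW := 1 / 4) (κ := κ) (ε₀ := 1 / 5) (ε₁ := 1 / 10) (c := 15053 / 200000)
    (lam := 55259 / 500000) (E₂ := 1105171 / 1000000) (q₁ := 515389 / 500000) (Ks := 1109187 / 500000) (Sq := 1000001 / 1000000) (t := 1 / 100)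
    (T₁ := 1010051 / 1000000) (T₂ := 510101 / 500000) (by norm_num) (by norm_num) (by norm_num) (by norm_num) hκ
    exp_le_1_5_pvw (by rw [show (1 / 5 : ℝ) / 2 = 1 / 10 by norm_num]; exact exp_le_1_10_star) (by norm_num) (by norm_num) (by norm_num) (by norm_num)
    (by norm_num) (by norm_num) exp_le_1_100_w (by rw [show (2:ℝ) * (1 / 100) = 1 / 50 by norm_num]; exact exp_le_1_50_w)
    (by norm_num) (by norm_num) (by norm_num) (by unfold doorPoly; norm_num) (by unfold gaugeR Delta; norm_num)
  have e2 : (2 : ℝ) * (1 / 100) = 1 / 50 := by norm_num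
  rw [e1, e2, e3] at h
  exact h

/-- **TIER-2 ROW `(β_W, ε) = (1 / 4, 31 / 500)`, `SU(3)`, `d = 4`, HYPOTHESIS-FREE, PV-variance star door**, the lineage weight and rate `κ = t = log(6/5)`
(certificate: `K_s = 1109187 / 500000`, `S_q = 1000001 / 1000000`, `c = 69757 / 1000000`, `λ = 32983 / 500000`, `ρ ≈ 0.9978`). [folklore] -/
theorem su3_torusClusteringOnBallW_starPV_oneQuarter_w65 :
    ∀ β : ℝ, 0 ≤ β → β ≤ 1 / 12 →
      TorusClusteringOnBallW 3 4 β (Real.log (6 / 5)) (31 / 250) (31 / 500) (24 * Real.exp (2 * Real.log (6 / 5))) (Real.log (6 / 5)) := by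
  have e1 : (1 / 4 : ℝ) / ((3 : ℕ) : ℝ) = 1 / 12 := by norm_num
  have e3 : (8 : ℝ) * ((3 : ℕ) : ℝ) = 24 := by norm_num
  have h := suN_torusClusteringOnBallW_star_pv 20 (N := 3) (by norm_num) (βW := 1 / 4) (κ := Real.log (6 / 5)) (ε₀ := 31 / 250) (ε₁ := 31 / 500) (c := 69757 / 1000000)
    (lam := 32983 / 500000) (E₂ := 1063963 / 1000000) (q₁ := 515389 / 500000) (Ks := 1109187 / 500000) (Sq := 1000001 / 1000000) (t := Real.log (6 / 5))
    (T₁ := 6 / 5) (T₂ := 36 / 25) (by norm_num) (by norm_num) (by norm_num) (Real.log_nonneg (by norm_num)) le_rfl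
    exp_le_31_250_pvw (by rw [show (31 / 250 : ℝ) / 2 = 31 / 500 by norm_num]; exact exp_le_31_500_pvw) (by norm_num) (by norm_num) (by norm_num) (by norm_num)
    (by norm_num) (by norm_num) (by rw [Real.exp_log (by norm_num)]) (by rw [show (2:ℝ) * Real.log (6 / 5) = Real.log ((6 / 5) ^ 2) by rw [Real.log_pow]; norm_num, Real.exp_log (by norm_num)]; norm_num)
    (by norm_num) (by norm_num) (by norm_num) (by unfold doorPoly; norm_num) (by unfold gaugeR Delta; norm_num)
  rw [e1, e3] at h
  exact h

/-- **TIER-2 ROW `(β_W, ε) = (1 / 3, 71 / 500)`, `SU(3)`, `d = 3`, HYPOTHESIS-FREE, PV-variance star door**, rate `1/100` per lattice unit, EVERY weight `κ ≥ 1/100`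
(certificate: `K_s = 2101617 / 1000000`, `S_q = 97333 / 100000`, `c = 103403 / 1000000`, `λ = 159301 / 1000000`, `ρ ≈ 0.9987`). [folklore] -/
theorem su3_clusterDomainClusteringW_dim3_starPV_oneThird_t100 :
    ∀ κ : ℝ, 1 / 100 ≤ κ → YM3IR.ClusterDomainClustering (G := SUN 3)
          ⟨fundamentalRep (Fin 3), 1 / 9, fun _ _ W => W ∈ ClusterDomain κ (71 / 250) (71 / 500)⟩ suFrobDist (1 / 100) ∧
        ∀ β : ℝ, 0 ≤ β → β ≤ 1 / 9 →
          TorusClusteringOnBallW 3 3 β κ (71 / 250) (71 / 500) (24 * Real.exp (1 / 50)) (1 / 100) := by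
  intro κ hκ
  have e1 : (1 / 3 : ℝ) / ((3 : ℕ) : ℝ) = 1 / 9 := by norm_num
  have e3 : (8 : ℝ) * ((3 : ℕ) : ℝ) = 24 := by norm_num
  have h := suN_clusterDomainClusteringW_dim3_star_pv 20 (N := 3) (by norm_num) (βW := 1 / 3) (κ := κ) (ε₀ := 71 / 250) (ε₁ := 71 / 500) (c := 103403 / 1000000)
    (lam := 159301 / 1000000) (E₂ := 1152577 / 1000000) (q₁ := 204879 / 200000) (Ks := 2101617 / 1000000) (Sq := 97333 / 100000) (t := 1 / 100)
    (T₁ := 1010051 / 1000000) (T₂ := 510101 / 500000) (by norm_num) (by norm_num) (by norm_num) (by norm_num) hκ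
    exp_le_71_250_pvw (by rw [show (71 / 250 : ℝ) / 2 = 71 / 500 by norm_num]; exact exp_le_71_500_pvw) (by norm_num) (by norm_num) (by norm_num) (by norm_num)
    (by norm_num) (by norm_num) exp_le_1_100_w (by rw [show (2:ℝ) * (1 / 100) = 1 / 50 by norm_num]; exact exp_le_1_50_w)
    (by norm_num) (by norm_num) (by norm_num) (by unfold doorPoly; norm_num) (by unfold gaugeR Delta; norm_num)
  have e2 : (2 : ℝ) * (1 / 100) = 1 / 50 := by norm_num
  rw [e1, e2, e3] at h
  exact h

/-- **TIER-2 ROW `(β_W, ε) = (1 / 3, 49 / 500)`, `SU(3)`, `d = 3`, HYPOTHESIS-FREE, PV-variance star door**, the lineage weight and rate `κ = t = log(6/5)`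
(certificate: `K_s = 2101617 / 1000000`, `S_q = 97333 / 100000`, `c = 23673 / 250000`, `λ = 13151 / 125000`, `ρ ≈ 0.9945`). [folklore] -/
theorem su3_clusterDomainClusteringW_dim3_starPV_oneThird_w65 :
    YM3IR.ClusterDomainClustering (G := SUN 3)
          ⟨fundamentalRep (Fin 3), 1 / 9, fun _ _ W => W ∈ ClusterDomain (Real.log (6 / 5)) (49 / 250) (49 / 500)⟩ suFrobDist (Real.log (6 / 5)) ∧
        ∀ β : ℝ, 0 ≤ β → β ≤ 1 / 9 →
          TorusClusteringOnBallW 3 3 β (Real.log (6 / 5)) (49 / 250) (49 / 500) (24 * Real.exp (2 * Real.log (6 / 5))) (Real.log (6 / 5)) := by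
  have e1 : (1 / 3 : ℝ) / ((3 : ℕ) : ℝ) = 1 / 9 := by norm_num
  have e3 : (8 : ℝ) * ((3 : ℕ) : ℝ) = 24 := by norm_num
  have h := suN_clusterDomainClusteringW_dim3_star_pv 20 (N := 3) (by norm_num) (βW := 1 / 3) (κ := Real.log (6 / 5)) (ε₀ := 49 / 250) (ε₁ := 49 / 500) (c := 23673 / 250000)
    (lam := 13151 / 125000) (E₂ := 1.102963) (q₁ := 204879 / 200000) (Ks := 2101617 / 1000000) (Sq := 97333 / 100000) (t := Real.log (6 / 5))
    (T₁ := 6 / 5) (T₂ := 36 / 25) (by norm_num) (by norm_num) (by norm_num) (Real.log_nonneg (by norm_num)) le_rfl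
    exp_le_49_250_cstar3 (by rw [show (49 / 250 : ℝ) / 2 = 49 / 500 by norm_num]; exact exp_098_le) (by norm_num) (by norm_num) (by norm_num) (by norm_num)
    (by norm_num) (by norm_num) (by rw [Real.exp_log (by norm_num)]) (by rw [show (2:ℝ) * Real.log (6 / 5) = Real.log ((6 / 5) ^ 2) by rw [Real.log_pow]; norm_num, Real.exp_log (by norm_num)]; norm_num)
    (by norm_num) (by norm_num) (by norm_num) (by unfold doorPoly; norm_num) (by unfold gaugeR Delta; norm_num)
  rw [e1, e3] at h
  exact h

end Summit.Ventures.YMGap.RobustBall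

end
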